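import Summits.CriticalPhenomena.CardyFormulaZ2.Theorems.CardyIKTransportIKLinearTransportTwoCutDefs

/-!
# Stub `stub_TwoCutGauge` (K₂) — THE RECTANGLE PROPERTY of the pull-back of an atom in the cut-adapted gauge

`--supports stmt-CriticalPhenomena-5076`; proves the registered stub `stub_TwoCutGauge` BY NAME.

In the gauge `cmkΞ i T c` (`…StubCutMarkovKernelBits.lean`) anchored at the last cut row `c = cmkCstar ≤ -1`, with
first cut row `c' = cmkCfirst ≥ 1`, the inner noise `tcNin` (iso biased plaquettes of the rows `[c, c')`, iso coins
of the rows `(c, c')`) is upper noise (`tcg_Nin_subset_Gb`). On the pull-back `tcE` of an atom the following coded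
data are PINNED (`tcg_pinned_rel`): row bits, right colours and fair plaquettes of the window rows `[c-2, c'+2]`
(read off the environment, `cmk_env_reads`), the two column bits (forced middle colour at the cut `c`) and the parity
`Π^B_{c → c'}` of the inner plaquettes (forced middle colour at the cut `c'`). Hence (`tcg_agree_off/on`) agreement
OFF the inner noise with equal inner parity gives the same boundary, environment, and middle cells / strip faces of
the rows `≤ c` and `≥ c'`; agreement ON it plus the pinned data gives the same middle cells of the rows `[c, c']` and
strip faces of the rows `(c, c')`; the half-strip and window reachabilities read exactly these (`tcg_halves_congr`,
`tcg_RW_flat_congr`). With the two-cut combinatorics `TwoCutComb i` as HYPOTHESIS this gives `TcGaugeRect i T`: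
(R2) `tcg_rowBool_congr`; (R3) `tcg_rowStat_congr` — environment and lower half-strip by `cmk_agree_lo`, rows
`(c, 0)` pinned by the past, strip diagram assembled at `c` (`cmk_stripDiagram_eq_comb`, clause (D)) from the lower
reachability, the RIGID window reachability (clause (B)) and the upper half-diagram at `c'` (rows `≥ c'`, pinned
parity); (R1) `tcg_glue_mem` — the glued point has the lower/upper data of the first point and the window data of the
second, hence the two cuts (clause (C)), the strip diagram of the first (clauses (D), (E), (B)) and its environment.
-/

noncomputable section

namespace Summit.CriticalPhenomena.CardyFormulaZ2.Theorems.IKLinearTransport.PinnedDiagramExchange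

open scoped Classical MeasureTheory ENNReal symmDiff
open Set MeasureTheory
open Literature.Probability.Percolation Literature.Probability.LatticeModels

/-! ## The inner noise -/

/-- Membership of the basic coordinates in the inner noise. [folklore] -/
theorem tcg_mem_Nin (i : ℤ) (τ : Bool) (c c' : ℤ) :
    (∀ x, jCB x ∉ tcNin i τ c c') ∧ (∀ y, jRB y ∉ tcNin i τ c c') ∧ (∀ f, jFP f ∉ tcNin i τ c c') ∧
    (∀ s, jBP ![SDE.isoC i τ, s] ∈ tcNin i τ c c' ↔ c ≤ s ∧ s < c') ∧
    (∀ y, jCO ![SDE.isoC i τ, y] ∈ tcNin i τ c c' ↔ c < y ∧ y < c') := by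
  refine ⟨fun x => ?_, fun y => ?_, fun f => ?_, fun s => ?_, fun y => ?_⟩ <;>
    simp only [tcNin, mem_setOf_eq, jCB, jRB, jBP, jFP, jCO, Sum.inl.injEq, Sum.inr.injEq, reduceCtorEq,
      and_false, exists_false, or_false, false_or, or_self, not_false_eq_true, SquareTiling.vec2_eq_iff, true_and]
  · exact ⟨fun ⟨s', h1, h2, e⟩ => e ▸ ⟨h1, h2⟩, fun h => ⟨s, h.1, h.2, rfl⟩⟩
  · exact ⟨fun ⟨y', h1, h2, e⟩ => e ▸ ⟨h1, h2⟩, fun h => ⟨y, h.1, h.2, rfl⟩⟩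

/-- THE INNER NOISE IS UPPER NOISE for the gauge anchored at the last cut row: the lower strip, the boundary
columns and the environment do not read it. [folklore] -/
theorem tcg_Nin_subset_Gb : ∀ (i : ℤ) (τ : Bool) (c c' : ℤ), tcNin i τ c c' ⊆ cmkGb i τ c := by
  rintro i τ c c' j (⟨s, h1, -, rfl⟩ | ⟨y, h1, -, rfl⟩)
  · exact Or.inl ⟨s, h1, rfl⟩
  · exact Or.inr ⟨y, by omega, rfl⟩

/-! ## Reading lemmas in the cut-adapted gauge -/

/-- Middle cells at or above the upper cut row `c'` read the column bit of column `i+1`, the row bit, the fair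
plaquettes, the inner parity `Π^B_{c → c'}` and the biased plaquettes of the rows `≥ c'`. [folklore] -/
theorem tcg_mid_up_congr (i : ℤ) (τ : Bool) (c c' : ℤ) {g₁ g₂ : SDE.KJ} {y : ℤ}
    (h1 : g₁ (jCB (i + 1)) = g₂ (jCB (i + 1))) (hr : g₁ (jRB y) = g₂ (jRB y))
    (hF : ∀ s, cmkF i τ g₁ s = cmkF i τ g₂ s) (hπ : SDE.bp (cmkB i τ g₁) c c' = SDE.bp (cmkB i τ g₂) c c')
    (hB : ∀ s, c' ≤ s → cmkB i τ g₁ s = cmkB i τ g₂ s) (hy : c' ≤ y) : cmkMi i τ c g₁ y = cmkMi i τ c g₂ y := by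
  have hF' : SDE.bp (cmkF i τ g₁) 0 y = SDE.bp (cmkF i τ g₂) 0 y := cmk_bp_congr' fun s _ => hF s
  have hB' : SDE.bp (cmkB i τ g₁) c' y = SDE.bp (cmkB i τ g₂) c' y :=
    cmk_bp_congr' fun s hs => hB s (by rw [Finset.mem_Ico] at hs; omega)
  unfold cmkMi
  rw [SDE.bp_chasles (cmkB i τ g₁) c c' y, SDE.bp_chasles (cmkB i τ g₂) c c' y, h1, hr, hF', hπ, hB']

/-- Window reachability on `cmkFlat i c ·` between the rows `c ≤ c'` reads the strip cells of the rows `[c, c']`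
and the strip faces of the rows `(c, c')` (the row-`c` faces being set). [folklore] -/
theorem tcg_RW_flat_congr (i c c' : ℤ) {x x' : Obs}
    (h1 : ∀ v : Site 2, i ≤ v 0 → v 0 ≤ i + 2 → c ≤ v 1 → v 1 ≤ c' → (v ∈ x.1 ↔ v ∈ x'.1))
    (h2 : ∀ f : Site 2, (f 0 = i ∨ f 0 = i + 1) → c < f 1 → f 1 < c' → (f ∈ x.2 ↔ f ∈ x'.2)) :
    cmkRW i c c' (cmkFlat i c x) = cmkRW i c c' (cmkFlat i c x') := by
  have hf : ∀ {x x' : Obs}, (∀ f : Site 2, (f 0 = i ∨ f 0 = i + 1) → c < f 1 → f 1 < c' → (f ∈ x.2 ↔ f ∈ x'.2)) →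
      ∀ f : Site 2, (f 0 = i ∨ f 0 = i + 1) → c ≤ f 1 → f 1 < c' → (f ∈ (cmkFlat i c x).2 ↔ f ∈ (cmkFlat i c x').2) := by
    intro x x' h2 f hf0 hf1 hf2
    by_cases hfc : f 1 = c
    · have : f = ![i, c] ∨ f = ![i + 1, c] := by
        rcases hf0 with e | e
        · left; rw [← SDE.site2_eta f, e, hfc]
        · right; rw [← SDE.site2_eta f, e, hfc]
      simp only [cmkFlat, mem_setOf_eq]
      constructor <;> intro _ <;> exact Or.inr this
    · simp only [cmkFlat, mem_setOf_eq, h2 f hf0 (by omega) hf2]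
  exact Subset.antisymm (cmkRW_congr_obs i _ _ (fun v a b e d => h1 v a b e d) (hf h2))
    (cmkRW_congr_obs i _ _ (fun v a b e d => (h1 v a b e d).symm) (hf fun f a b e => (h2 f a b e).symm))

/-- Half-strip data from cell/face agreement: the lower reachability and the pattern at `c`, the flattened upper
reachability and the pattern at `c'`. [folklore] -/
theorem tcg_halves_congr (i c c' : ℤ) {x x' : Obs}
    (hbd : ∀ v : Site 2, (v 0 = i ∨ v 0 = i + 2) → (v ∈ x.1 ↔ v ∈ x'.1))
    (hlo : ∀ v : Site 2, v 0 = i + 1 → v 1 ≤ c → (v ∈ x.1 ↔ v ∈ x'.1))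
    (hup : ∀ v : Site 2, v 0 = i + 1 → c' ≤ v 1 → (v ∈ x.1 ↔ v ∈ x'.1))
    (hflo : ∀ f : Site 2, (f 0 = i ∨ f 0 = i + 1) → f 1 ≤ c → (f ∈ x.2 ↔ f ∈ x'.2))
    (hfup : ∀ f : Site 2, (f 0 = i ∨ f 0 = i + 1) → c' ≤ f 1 → (f ∈ x.2 ↔ f ∈ x'.2)) :
    cmkLoR i c x = cmkLoR i c x' ∧ (cmkPattern i c x ↔ cmkPattern i c x') ∧
      cmkUpR i c' (cmkFlat i c' x) = cmkUpR i c' (cmkFlat i c' x') ∧ (cmkPattern i c' x ↔ cmkPattern i c' x') := by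
  have key : ∀ a y : ℤ, (a = i ∨ a = i + 2) → ((![a, y] : Site 2) ∈ x.1 ↔ (![a, y] : Site 2) ∈ x'.1) :=
    fun a y h => hbd _ (by simpa using h)
  refine ⟨?_, ?_, ?_, ?_⟩
  · exact cmk_LoR_congr i c (fun v hv hv' hv1 => by
      rcases (show v 0 = i ∨ v 0 = i + 1 ∨ v 0 = i + 2 by omega) with e | e | e
      · exact hbd v (Or.inl e)
      · exact hlo v e hv1
      · exact hbd v (Or.inr e)) (fun f hf hf1 => hflo f hf hf1.le)
  · simp only [cmkPattern, key _ _ (Or.inl rfl), key _ _ (Or.inr rfl)]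
  · exact cmk_UpR_flat_congr i c' (fun v hv hv' hv1 => by
      rcases (show v 0 = i ∨ v 0 = i + 1 ∨ v 0 = i + 2 by omega) with e | e | e
      · exact hbd v (Or.inl e)
      · exact hup v e hv1
      · exact hbd v (Or.inr e)) (fun f hf hf1 => hfup f hf (by omega))
  · simp only [cmkPattern, key _ _ (Or.inl rfl), key _ _ (Or.inr rfl)]

section Gauge

variable (i : ℤ) {T : Set ℤ} (c c' : ℤ) (hT : i ∈ T ↔ i + 1 ∉ T) {τ : Bool} (hτ : decide (i ∈ T) = τ)
include hT hτ

/-- Strip faces read only the coin of their row. [folklore] -/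
theorem tcg_face_congr {g₁ g₂ : SDE.KJ} (f : Site 2) (hf : f 0 = i ∨ f 0 = i + 1)
    (h : cmkTi i τ g₁ (f 1) = cmkTi i τ g₂ (f 1)) : f ∈ (cmkΞ i T c g₁).2 ↔ f ∈ (cmkΞ i T c g₂).2 := by
  rcases hf with e | e
  · rw [cmk_mem_Xi2_col0 i c hτ g₁ f e, cmk_mem_Xi2_col0 i c hτ g₂ f e, h]
  · rw [cmk_mem_Xi2_col1 i c hT hτ g₁ f e, cmk_mem_Xi2_col1 i c hT hτ g₂ f e, h]

/-- Boundary cells of the rows `[lo, hi]` read only the row bits and right colours of these rows. [folklore] -/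
theorem tcg_bd_congr {g₁ g₂ : SDE.KJ} {lo hi : ℤ}
    (h : ∀ y, lo ≤ y → y ≤ hi → g₁ (jRB y) = g₂ (jRB y) ∧ cmkZe i τ g₁ y = cmkZe i τ g₂ y ∧
      SDE.bp (cmkF i τ g₁) 0 y = SDE.bp (cmkF i τ g₂) 0 y)
    (v : Site 2) (hv : v 0 = i ∨ v 0 = i + 2) (h1 : lo ≤ v 1) (h2 : v 1 ≤ hi) :
    v ∈ (cmkΞ i T c g₁).1 ↔ v ∈ (cmkΞ i T c g₂).1 := by
  rcases hv with e | e
  · rw [cmk_mem_Xi_col0 i c hτ g₁ v e, cmk_mem_Xi_col0 i c hτ g₂ v e, cmkXi, cmkXi, (h _ h1 h2).1]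
  · rw [cmk_mem_Xi_col2 i c hT hτ g₁ v e, cmk_mem_Xi_col2 i c hT hτ g₂ v e, (h _ h1 h2).2.1]

/-- WHAT AGREEMENT OFF THE INNER NOISE GIVES (with the same inner parity): the same boundary columns, middle cells of
the rows `≤ c` and `≥ c'`, strip faces of the rows `≤ c` and `≥ c'`, and the same environment. [folklore] -/
theorem tcg_agree_off {g₀ g₁ : SDE.KJ} (hoff : ∀ j ∉ tcNin i τ c c', g₁ j = g₀ j)
    (hπ : SDE.bp (cmkB i τ g₁) c c' = SDE.bp (cmkB i τ g₀) c c') :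
    (∀ v : Site 2, (v 0 = i ∨ v 0 = i + 2) → (v ∈ (cmkΞ i T c g₁).1 ↔ v ∈ (cmkΞ i T c g₀).1)) ∧
    (∀ v : Site 2, v 0 = i + 1 → v 1 ≤ c → (v ∈ (cmkΞ i T c g₁).1 ↔ v ∈ (cmkΞ i T c g₀).1)) ∧
    (∀ v : Site 2, v 0 = i + 1 → c' ≤ v 1 → (v ∈ (cmkΞ i T c g₁).1 ↔ v ∈ (cmkΞ i T c g₀).1)) ∧
    (∀ f : Site 2, (f 0 = i ∨ f 0 = i + 1) → f 1 ≤ c → (f ∈ (cmkΞ i T c g₁).2 ↔ f ∈ (cmkΞ i T c g₀).2)) ∧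
    (∀ f : Site 2, (f 0 = i ∨ f 0 = i + 1) → c' ≤ f 1 → (f ∈ (cmkΞ i T c g₁).2 ↔ f ∈ (cmkΞ i T c g₀).2)) ∧
    eraseMid i (cmkΞ i T c g₁) = eraseMid i (cmkΞ i T c g₀) := by
  obtain ⟨hNx, hNr, hNF, hNB, hNC⟩ := tcg_mem_Nin i τ c c'
  have hGb : ∀ j, j ∉ cmkGb i τ c → g₁ j = g₀ j := fun j hj => hoff j fun h => hj (tcg_Nin_subset_Gb i τ c c' h)
  obtain ⟨hbd, hlo, hflo, hE⟩ := cmk_agree_lo i c hT hτ hGb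
  have hx1 : g₁ (jCB (i + 1)) = g₀ (jCB (i + 1)) := hoff _ (hNx _)
  have hF : ∀ s, cmkF i τ g₁ s = cmkF i τ g₀ s := fun s => hoff _ (hNF _)
  have hB : ∀ s, c' ≤ s → cmkB i τ g₁ s = cmkB i τ g₀ s := fun s hs => hoff _ fun h => by have := ((hNB s).1 h).2; omega
  refine ⟨hbd, hlo, fun v hv0 hv1 => ?_, hflo, fun f hf0 hf1 => ?_, hE⟩
  · rw [cmk_mem_Xi_col1 i c hτ g₁ v hv0, cmk_mem_Xi_col1 i c hτ g₀ v hv0,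
      tcg_mid_up_congr i τ c c' hx1 (hoff _ (hNr _)) hF hπ hB hv1]
  · exact tcg_face_congr i c hT hτ f hf0 (hoff _ fun h => by have := ((hNC (f 1)).1 h).2; omega)

/-- WHAT AGREEMENT ON THE INNER NOISE GIVES, together with the pinned data of the window: the same middle cells of the
rows `[c, c']` and the same strip faces of the rows `(c, c')`. [folklore] -/
theorem tcg_agree_on (hc : c ≤ -1) (hc' : 1 ≤ c') {g₁ g₂ : SDE.KJ} (hon : ∀ j ∈ tcNin i τ c c', g₁ j = g₂ j)
    (h1 : g₁ (jCB (i + 1)) = g₂ (jCB (i + 1))) (hr : ∀ y, c - 2 ≤ y → y ≤ c' + 2 → g₁ (jRB y) = g₂ (jRB y))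
    (hF : ∀ y, c - 2 ≤ y → y ≤ c' + 1 → cmkF i τ g₁ y = cmkF i τ g₂ y) :
    (∀ v : Site 2, v 0 = i + 1 → c ≤ v 1 → v 1 ≤ c' → (v ∈ (cmkΞ i T c g₁).1 ↔ v ∈ (cmkΞ i T c g₂).1)) ∧
    (∀ f : Site 2, (f 0 = i ∨ f 0 = i + 1) → c < f 1 → f 1 < c' → (f ∈ (cmkΞ i T c g₁).2 ↔ f ∈ (cmkΞ i T c g₂).2)) := by
  obtain ⟨-, -, -, hNB, hNC⟩ := tcg_mem_Nin i τ c c'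
  refine ⟨fun v hv0 hv1 hv2 => ?_, fun f hf0 hf1 hf2 => ?_⟩
  · have hF' : ∀ s ∈ Finset.Ico (min 0 (v 1)) (max 0 (v 1)), cmkF i τ g₁ s = cmkF i τ g₂ s := fun s hs =>
      hF s (by rw [Finset.mem_Ico] at hs; omega) (by rw [Finset.mem_Ico] at hs; omega)
    have hB' : ∀ s ∈ Finset.Ico (min c (v 1)) (max c (v 1)), cmkB i τ g₁ s = cmkB i τ g₂ s := fun s hs =>
      hon _ ((hNB s).2 (by rw [Finset.mem_Ico] at hs; omega))
    rw [cmk_mem_Xi_col1 i c hτ g₁ v hv0, cmk_mem_Xi_col1 i c hτ g₂ v hv0,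
      cmkMi_congr h1 (hr _ (by omega) (by omega)) hF' hB']
  · exact tcg_face_congr i c hT hτ f hf0 (hon _ ((hNC (f 1)).2 ⟨hf1, hf2⟩))

end Gauge

/-! ## The pull-back of an atom: cuts and pinned data -/

section Atom

variable (i : ℤ) {T : Set ℤ} {τ : Bool} {p : Obs × Set (Site 2 × Site 2)} {z : Obs} {c c' : ℤ}

/-- A point of the pull-back of the atom has the two cut rows `c`, `c'` and the window data of `p`. [folklore] -/
theorem tcg_cuts (hc : c ≤ -1) (hc' : 1 ≤ c') (hpc : cmkCstar i p = c) (hpc' : cmkCfirst i p = c') {g : SDE.KJ}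
    (hg : cmkΞ i T c g ∈ tcAtom i p ∩ tcZev i c z) :
    IsCut i c (pinnedStat i (cmkΞ i T c g)) ∧ IsCut i c' (pinnedStat i (cmkΞ i T c g)) ∧
      EnvAgree i (c - 2) (c' + 2) (pinnedStat i (cmkΞ i T c g)) p := by
  obtain ⟨⟨h1, h2, h3⟩, -⟩ := hg
  rw [hpc] at h1 h3
  rw [hpc'] at h2 h3
  exact ⟨cmk_isCut_of_cstar i hc h1, cmk_isCut_of_cfirst i hc' h2, h3⟩

/-- THE PINNED DATA. Two points of the pull-back of an atom have the same column bits of the columns `i+1, i+2`,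
the same inner parity `Π^B_{c → c'}`, and, on the window rows `[c-2, c'+2]`, the same row bits, right colours and
fair parities (fair plaquettes on the rows `[c-2, c'+1]`). [folklore] -/
theorem tcg_pinned_rel (hT : i ∈ T ↔ i + 1 ∉ T) (hτ : decide (i ∈ T) = τ) (hc : c ≤ -1) (hc' : 1 ≤ c')
    (hpc : cmkCstar i p = c) (hpc' : cmkCfirst i p = c') {g g' : SDE.KJ}
    (hg : cmkΞ i T c g ∈ tcAtom i p ∩ tcZev i c z) (hg' : cmkΞ i T c g' ∈ tcAtom i p ∩ tcZev i c z) :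
    g (jCB (i + 1)) = g' (jCB (i + 1)) ∧ g (jCB (i + 2)) = g' (jCB (i + 2)) ∧
    SDE.bp (cmkB i τ g) c c' = SDE.bp (cmkB i τ g') c c' ∧
    (∀ y, c - 2 ≤ y → y ≤ c' + 2 → g (jRB y) = g' (jRB y) ∧ cmkZe i τ g y = cmkZe i τ g' y ∧
      SDE.bp (cmkF i τ g) 0 y = SDE.bp (cmkF i τ g') 0 y) ∧
    (∀ y, c - 2 ≤ y → y ≤ c' + 1 → cmkF i τ g y = cmkF i τ g' y) := by
  obtain ⟨hcg, hcg', hag⟩ := tcg_cuts i hc hc' hpc hpc' hg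
  obtain ⟨hdg, hdg', hag'⟩ := tcg_cuts i hc hc' hpc hpc' hg'
  have hA : EnvAgree i (c - 2) (c' + 2) (pinnedStat i (cmkΞ i T c g)) (pinnedStat i (cmkΞ i T c g')) :=
    envAgree_trans hag (envAgree_symm hag')
  -- boundary colours and fair plaquettes in the window are read off the environment
  have hξ : ∀ y, c - 2 ≤ y → y ≤ c' + 2 → cmkXi g y = cmkXi g' y := fun y h1 h2 => by
    rw [← (cmk_env_reads i c hT hτ g y).1, ← (cmk_env_reads i c hT hτ g' y).1]
    unfold cmkξE
    exact decide_eq_decide.2 (hA.1 ![i, y] (by simp) (by simp) (by simpa using h1) (by simpa using h2)).1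
  have hζ : ∀ y, c - 2 ≤ y → y ≤ c' + 2 → cmkZe i τ g y = cmkZe i τ g' y := fun y h1 h2 => by
    rw [← (cmk_env_reads i c hT hτ g y).2.1, ← (cmk_env_reads i c hT hτ g' y).2.1]
    unfold cmkζE
    exact decide_eq_decide.2 (hA.1 ![i + 2, y] (by simp) (by simp) (by simpa using h1) (by simpa using h2)).1
  have hF : ∀ y, c - 2 ≤ y → y ≤ c' + 1 → cmkF i τ g y = cmkF i τ g' y := fun y h1 h2 => by
    rw [← (cmk_env_reads i c hT hτ g y).2.2, ← (cmk_env_reads i c hT hτ g' y).2.2]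
    simp only [cmkFE]
    rw [(cmk_env_reads i c hT hτ g y).1, (cmk_env_reads i c hT hτ g y).2.1,
      (cmk_env_reads i c hT hτ g (y + 1)).1, (cmk_env_reads i c hT hτ g (y + 1)).2.1,
      (cmk_env_reads i c hT hτ g' y).1, (cmk_env_reads i c hT hτ g' y).2.1,
      (cmk_env_reads i c hT hτ g' (y + 1)).1, (cmk_env_reads i c hT hτ g' (y + 1)).2.1,
      hξ y (by omega) (by omega), hζ y (by omega) (by omega), hξ (y + 1) (by omega) (by omega),
      hζ (y + 1) (by omega) (by omega)]
  have hbF : ∀ y, c - 2 ≤ y → y ≤ c' + 2 → SDE.bp (cmkF i τ g) 0 y = SDE.bp (cmkF i τ g') 0 y := fun y h1 h2 =>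
    cmk_bp_congr' fun s hs => hF s (by rw [Finset.mem_Ico] at hs; omega) (by rw [Finset.mem_Ico] at hs; omega)
  have hr : ∀ y, c - 2 ≤ y → y ≤ c' + 2 → g (jRB y) = g' (jRB y) := hξ
  -- the column bit of column `i+2` from the right colour of row `0`
  have h2 : g (jCB (i + 2)) = g' (jCB (i + 2)) := by
    have e := hζ 0 (by omega) (by omega)
    have e' := hr 0 (by omega) (by omega)
    simp only [cmkZe, SDE.bp_zero, Bool.xor_false] at e
    rw [e'] at e
    revert e
    cases g (jCB (i + 2)) <;> cases g' (jCB (i + 2)) <;> cases g' (jRB 0) <;> decide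
  -- the forced middle colour at a cut row `e` reads the column bit of column `i+1` and the parity `Π^B_{c → e}`
  have key : ∀ (b : SDE.KJ) (e : ℤ), IsCut i e (pinnedStat i (cmkΞ i T c b)) →
      SDE.bp (cmkB i τ b) c e = !(b (jCB (i + 1)) ^^ (!τ && SDE.bp (cmkF i τ b) 0 e)) := by
    intro b e he
    have h1 := isCut_forces_mid i e _ he e (by omega) (by omega)
    rw [cmk_mem_Xi_col1 i c hτ b _ (by simp), cmk_mem_Xi_col0 i c hτ b _ (by simp)] at h1
    have e1 : (![i + 1, e] : Site 2) 1 = e := by simp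
    have e0 : (![i, e] : Site 2) 1 = e := by simp
    rw [e1, e0] at h1
    unfold cmkMi cmkXi at h1
    revert h1
    cases b (jCB (i + 1)) <;> cases b (jRB e) <;> cases (!τ && SDE.bp (cmkF i τ b) 0 e) <;>
      cases SDE.bp (cmkB i τ b) c e <;> decide
  have h1 : g (jCB (i + 1)) = g' (jCB (i + 1)) := by
    have e := key g c hcg
    have e' := key g' c hdg
    rw [cmk_bp_self] at e e'
    rw [hbF c (by omega) (by omega)] at e
    revert e e'
    cases g (jCB (i + 1)) <;> cases g' (jCB (i + 1)) <;> cases (!τ && SDE.bp (cmkF i τ g') 0 c) <;> decide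
  have hπ : SDE.bp (cmkB i τ g) c c' = SDE.bp (cmkB i τ g') c c' := by
    rw [key g c' hcg', key g' c' hdg', h1, hbF c' (by omega) (by omega)]
  exact ⟨h1, h2, hπ, fun y a b => ⟨hr y a b, hζ y a b, hbF y a b⟩, hF⟩

end Atom

/-! ## The rectangle property -/

section Rect

variable (i : ℤ) {T : Set ℤ} {τ : Bool} {p : Obs × Set (Site 2 × Site 2)} {z : Obs} {c c' : ℤ}

/-- (R2) ON THE PULL-BACK OF AN ATOM THE MIDDLE ROW `0` READS ONLY THE INNER NOISE. [folklore] -/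
theorem tcg_rowBool_congr (hT : i ∈ T ↔ i + 1 ∉ T) (hτ : decide (i ∈ T) = τ) (hc : c ≤ -1) (hc' : 1 ≤ c')
    (hpc : cmkCstar i p = c) (hpc' : cmkCfirst i p = c') {g g' : SDE.KJ}
    (hg : cmkΞ i T c g ∈ tcAtom i p ∩ tcZev i c z) (hg' : cmkΞ i T c g' ∈ tcAtom i p ∩ tcZev i c z)
    (hon : ∀ j ∈ tcNin i τ c c', g j = g' j) : rowBool i (cmkΞ i T c g) = rowBool i (cmkΞ i T c g') := by
  obtain ⟨h1, -, -, hw, hF⟩ := tcg_pinned_rel i hT hτ hc hc' hpc hpc' hg hg'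
  obtain ⟨hmid, hface⟩ := tcg_agree_on i c c' hT hτ hc hc' hon h1 (fun y a b => (hw y a b).1) hF
  simp only [rowBool, hmid ![i + 1, 0] (by simp) (by simp; omega) (by simp; omega),
    hface ![i, 0] (Or.inl (by simp)) (by simp; omega) (by simp; omega),
    hface ![i + 1, 0] (Or.inr (by simp)) (by simp; omega) (by simp; omega)]

/-- (R3) ON THE PULL-BACK OF AN ATOM THE ROW STATISTIC READS ONLY THE COORDINATES OFF THE INNER NOISE. [folklore] -/
theorem tcg_rowStat_congr (hT : i ∈ T ↔ i + 1 ∉ T) (hτ : decide (i ∈ T) = τ) (hTC : TwoCutComb i) (hc : c ≤ -1)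
    (hc' : 1 ≤ c') (hpc : cmkCstar i p = c) (hpc' : cmkCfirst i p = c') {g g' : SDE.KJ}
    (hg : cmkΞ i T c g ∈ tcAtom i p ∩ tcZev i c z) (hg' : cmkΞ i T c g' ∈ tcAtom i p ∩ tcZev i c z)
    (hoff : ∀ j ∉ tcNin i τ c c', g j = g' j) : rowStat i (cmkΞ i T c g) = rowStat i (cmkΞ i T c g') := by
  obtain ⟨hC, hD, hB, -⟩ := hTC
  obtain ⟨h1, h1', hag⟩ := tcg_cuts i hc hc' hpc hpc' hg
  obtain ⟨h2, h2', hag'⟩ := tcg_cuts i hc hc' hpc hpc' hg'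
  obtain ⟨-, -, hπ, -, -⟩ := tcg_pinned_rel i hT hτ hc hc' hpc hpc' hg hg'
  obtain ⟨hbd, hlo, hup, hflo, hfup, hE⟩ := tcg_agree_off i c c' hT hτ hoff hπ
  obtain ⟨hL, -, hU, -⟩ := tcg_halves_congr i c c' hbd hlo hup hflo hfup
  have hZ := hg.2; have hZ' := hg'.2
  set x := cmkΞ i T c g with hx
  set x' := cmkΞ i T c g' with hx'
  -- the strip diagram, assembled at the cut row `c`
  have hRWp : cmkRWp i c c' x = cmkRWp i c c' x' :=
    hB c c' x x' hc hc' h1 h1' h2 h2' (envAgree_trans hag (envAgree_symm hag'))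
  have hUp : cmkUpDp i c' x = cmkUpDp i c' x' := by
    have e : cmkUpR i c' x = cmkUpR i c' x' := by rw [← cmk_isCut_UpR_flat h1', ← cmk_isCut_UpR_flat h2', hU]
    simp only [cmkUpDp, e]
  have hΔ : stripDiagram i x = stripDiagram i x' := by
    rw [cmk_stripDiagram_eq_comb i c x h1, cmk_stripDiagram_eq_comb i c x' h2, hD c c' x hc hc' h1 h1',
      hD c c' x' hc hc' h2 h2', hL, hRWp, hUp]
  -- the past: rows `≤ c` off the inner noise, rows `(c, 0)` pinned by `z`
  have hc1 : ∀ w : Site 2, w 0 = i + 1 → w 1 < 0 → (w ∈ x.1 ↔ w ∈ x'.1) := fun w h0 hw1 => by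
    by_cases hwc : w 1 ≤ c
    · exact hlo w h0 hwc
    · exact ((hZ w (by omega) (by omega)).1 h0).trans ((hZ' w (by omega) (by omega)).1 h0).symm
  have hc2 : ∀ f : Site 2, (f 0 = i ∨ f 0 = i + 1) → f 1 < 0 → (f ∈ x.2 ↔ f ∈ x'.2) := fun f h0 hf1 => by
    by_cases hfc : f 1 ≤ c
    · exact hflo f h0 hfc
    · exact ((hZ f (by omega) (by omega)).2 h0).trans ((hZ' f (by omega) (by omega)).2 h0).symm
  have hP : pastMid i 0 x = pastMid i 0 x' := by
    refine Prod.ext (Set.ext fun w => ?_) (Set.ext fun f => ?_) <;> simp only [pastMid, mem_setOf_eq]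
    · exact ⟨fun ⟨hw, h0, hw1⟩ => ⟨(hc1 w h0 hw1).1 hw, h0, hw1⟩, fun ⟨hw, h0, hw1⟩ => ⟨(hc1 w h0 hw1).2 hw, h0, hw1⟩⟩
    · exact ⟨fun ⟨hf, h0, hf1⟩ => ⟨(hc2 f h0 hf1).1 hf, h0, hf1⟩, fun ⟨hf, h0, hf1⟩ => ⟨(hc2 f h0 hf1).2 hf, h0, hf1⟩⟩
  show ((eraseMid i x, stripDiagram i x), pastMid i 0 x) = ((eraseMid i x', stripDiagram i x'), pastMid i 0 x')
  rw [hE, hΔ, hP]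

/-- (R1) THE PULL-BACK OF AN ATOM IS STABLE UNDER IMPORTING THE INNER NOISE OF ANOTHER OF ITS POINTS. [folklore] -/
theorem tcg_glue_mem (hT : i ∈ T ↔ i + 1 ∉ T) (hτ : decide (i ∈ T) = τ) (hTC : TwoCutComb i) (hc : c ≤ -1)
    (hc' : 1 ≤ c') (hpc : cmkCstar i p = c) (hpc' : cmkCfirst i p = c') {g g' : SDE.KJ}
    (hg : cmkΞ i T c g ∈ tcAtom i p ∩ tcZev i c z) (hg' : cmkΞ i T c g' ∈ tcAtom i p ∩ tcZev i c z) :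
    cmkΞ i T c (SDE.glue (tcNin i τ c c') g g') ∈ tcAtom i p ∩ tcZev i c z := by
  obtain ⟨hC, hD, hB, hEfl⟩ := hTC
  obtain ⟨h1, h1', hag⟩ := tcg_cuts i hc hc' hpc hpc' hg
  obtain ⟨h2, h2', hag'⟩ := tcg_cuts i hc hc' hpc hpc' hg'
  obtain ⟨hκ, -, hπ, hw, hF⟩ := tcg_pinned_rel i hT hτ hc hc' hpc hpc' hg hg'
  obtain ⟨hNx, hNr, hNF, hNB, -⟩ := tcg_mem_Nin i τ c c'
  have hAt := hg.1; have hZ' := hg'.2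
  set g'' := SDE.glue (tcNin i τ c c') g g' with hg''
  have hoff : ∀ j ∉ tcNin i τ c c', g'' j = g j := fun j hj => by simp [hg'', SDE.glue, hj]
  have hon : ∀ j ∈ tcNin i τ c c', g'' j = g' j := fun j hj => by simp [hg'', SDE.glue, hj]
  -- the inner parity of the glued point is that of `g'`, which is the pinned one
  have hπ'' : SDE.bp (cmkB i τ g'') c c' = SDE.bp (cmkB i τ g) c c' := by
    rw [hπ]
    exact cmk_bp_congr' fun s hs => hon _ ((hNB s).2 (by rw [Finset.mem_Ico] at hs; omega))
  have hκ'' : g'' (jCB (i + 1)) = g' (jCB (i + 1)) := by rw [hoff _ (hNx _), hκ]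
  have hr'' : ∀ y, c - 2 ≤ y → y ≤ c' + 2 → g'' (jRB y) = g' (jRB y) := fun y a b => by rw [hoff _ (hNr _), (hw y a b).1]
  have hF'' : ∀ y, c - 2 ≤ y → y ≤ c' + 1 → cmkF i τ g'' y = cmkF i τ g' y := fun y a b => by
    rw [show cmkF i τ g'' y = cmkF i τ g y from hoff _ (hNF _), hF y a b]
  obtain ⟨hbd, hlo, hup, hflo, hfup, hE⟩ := tcg_agree_off i c c' hT hτ hoff hπ''
  obtain ⟨hmid, hface⟩ := tcg_agree_on i c c' hT hτ hc hc' hon hκ'' hr'' hF''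
  obtain ⟨hL, hPc, hU, hPc'⟩ := tcg_halves_congr i c c' hbd hlo hup hflo hfup
  set x'' := cmkΞ i T c g'' with hx''
  set x := cmkΞ i T c g with hx
  set x' := cmkΞ i T c g' with hx'
  -- the window of the glued point is that of `x'`
  have hW : cmkRW i c c' (cmkFlat i c x'') = cmkRW i c c' (cmkFlat i c x') := by
    refine tcg_RW_flat_congr i c c' (fun v hv0 hv0' hv1 hv2 => ?_) hface
    rcases (show v 0 = i ∨ v 0 = i + 1 ∨ v 0 = i + 2 by omega) with e | e | e
    · exact (hbd v (Or.inl e)).trans (tcg_bd_congr i c hT hτ hw v (Or.inl e) (by omega) (by omega))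
    · exact hmid v e hv1 hv2
    · exact (hbd v (Or.inr e)).trans (tcg_bd_congr i c hT hτ hw v (Or.inr e) (by omega) (by omega))
  -- the two cuts of the glued point (clause (C))
  have hcut : IsCut i c (pinnedStat i x'') ∧ IsCut i c' (pinnedStat i x'') := by
    obtain ⟨hlow, -, hhigh⟩ := (hC c c' x hc hc').1 ⟨h1, h1'⟩
    obtain ⟨-, hwin, -⟩ := (hC c c' x' hc hc').1 ⟨h2, h2'⟩
    unfold TcLow at hlow; unfold TcWin at hwin; unfold TcHigh at hhigh
    refine (hC c c' x'' hc hc').2 ⟨?_, ?_, ?_⟩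
    · unfold TcLow; rw [hPc, hL]; exact hlow
    · unfold TcWin; rw [hW]; exact hwin
    · unfold TcHigh; rw [hPc', hU]; exact hhigh
  obtain ⟨h3, h3'⟩ := hcut
  -- the strip diagram of the glued point is that of `x` (clauses (D), (E), (B))
  have hRWp : cmkRWp i c c' x'' = cmkRWp i c c' x := by
    have e : cmkRW i c c' x'' = cmkRW i c c' x' := by
      rw [← hEfl c c' x'' hc hc' h3 h3', ← hEfl c c' x' hc hc' h2 h2', hW]
    have e' : cmkRWp i c c' x'' = cmkRWp i c c' x' := by simp only [cmkRWp, e]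
    rw [e']
    exact hB c c' x' x hc hc' h2 h2' h1 h1' (envAgree_trans hag' (envAgree_symm hag))
  have hUp : cmkUpDp i c' x'' = cmkUpDp i c' x := by
    have e : cmkUpR i c' x'' = cmkUpR i c' x := by rw [← cmk_isCut_UpR_flat h3', ← cmk_isCut_UpR_flat h1', hU]
    simp only [cmkUpDp, e]
  have hΔ : stripDiagram i x'' = stripDiagram i x := by
    rw [cmk_stripDiagram_eq_comb i c x'' h3, cmk_stripDiagram_eq_comb i c x h1, hD c c' x'' hc hc' h3 h3',
      hD c c' x hc hc' h1 h1', hL, hRWp, hUp]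
  have hps : pinnedStat i x'' = pinnedStat i x := by
    show (eraseMid i x'', stripDiagram i x'') = (eraseMid i x, stripDiagram i x); rw [hE, hΔ]
  refine ⟨?_, fun w hw1 hw2 => ⟨fun h0 => ?_, fun h0 => ?_⟩⟩
  · simp only [tcAtom, mem_setOf_eq] at hAt ⊢
    rw [hps]
    exact hAt
  · exact (hmid w h0 (by omega) (by omega)).trans ((hZ' w hw1 hw2).1 h0)
  · exact (hface w h0 (by omega) (by omega)).trans ((hZ' w hw1 hw2).2 h0)

end Rect

/-- THE RECTANGLE PROPERTY IN THE CUT-ADAPTED GAUGE (registered stub `stub_TwoCutGauge`): for an environment value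
with a cut below and a cut above row `0` and a past, in the gauge anchored at the last cut, the pull-back of the atom
is stable under importing the inner noise of another of its points (R1), on it the middle row `0` reads only the
inner noise (R2), and the row statistic reads only the other coordinates (R3). [folklore] -/
theorem stub_TwoCutGauge : ∀ (i : ℤ) (T : Set ℤ), (i ∈ T ↔ i + 1 ∉ T) → TwoCutComb i → TcGaugeRect i T := by
  intro i T hT hTC p z hc hc'
  refine ⟨fun g g' hg hg' => ?_, fun g g' hg hg' hon => ?_, fun g g' hg hg' hoff => ?_⟩
  · exact tcg_glue_mem i hT rfl hTC hc hc' rfl rfl hg hg'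
  · exact tcg_rowBool_congr i hT rfl hc hc' rfl rfl hg hg' hon
  · exact tcg_rowStat_congr i hT rfl hTC hc hc' rfl rfl hg hg' hoff

end Summit.CriticalPhenomena.CardyFormulaZ2.Theorems.IKLinearTransport.PinnedDiagramExchange
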